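import Mathlib
import Literature.Geometry.DiscreteGeometry.KissingNodeDegree
import Literature.Geometry.DiscreteGeometry.SphericalCodeContactGraph
import Summits.AtomisticToContinuum.Crystallization.Theorems.SquareWellLayerCakeAveragedTwelveLensSix
import Summits.AtomisticToContinuum.Crystallization.Theorems.SquareWellLayerCakeAveragedTwelveLensPin
import HarnessLib

/-!
# Crux `SquareWellLayerCake.AveragedTwelve` (stmt-AtomisticToContinuum-15806), line `Sketch`
# (idea par-five-delaunay-recount), stub `stub_lensFive` — lens capacity five below `√5/2`

This file is stub `stub_lensFive` of line `Sketch` (idea par-five-delaunay-recount) of crux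
`SquareWellLayerCake.AveragedTwelve` (stmt-AtomisticToContinuum-15806): the ratio-pinned twin of
the lens lemmas `ParFiveRecountLensSix.stub_lensSix` (file
`SquareWellLayerCakeAveragedTwelveLensSix.lean`, whose frame and one-point estimates are reused)
and `ParFiveRecountLensPin.stub_lensPinning` (file `SquareWellLayerCakeAveragedTwelveLensPin.lean`,
the same conclusion for *long* pairs `(113/100) d ≤ ℓ`, whose counting step is copied).

**Statement.** Let `0 < d`, `ρ < (√5/2) d`, and let `x, y ∈ ℝ³` be a near pair,
`d ≤ ℓ := |xy| ≤ ρ`.  If `S` is a finite `d`-separated set of points `z` with `d ≤ |zx| ≤ ρ` and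
`d ≤ |zy| ≤ ρ` (the *lens* of the pair), then `|S| ≤ 5`.  (Sharp: for `ℓ = d = 1` the flat unit
hexagon in the mid-plane has all six vertices at distance exactly `√5/2` from both ends.)

**Proof.** In an orthonormal frame of `ℝ³` with third vector `n = (y − x)/ℓ`
(`ParFiveRecountLensSix.exists_frame`) write `z − x = (X, Y, H)`, `u = X² + Y² = r²` (`r ≥ 0`),
`h = H − ℓ/2`.  As `ρ² < (5/4) d² < (57/50)² d²`, one lens point satisfies
`u + 5h² ≤ A := ρ² − ℓ²/4` and `u ≥ L := d² − ℓ²/4 ≥ d² − ρ²/4 > (11/16) d² > 0`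
(`ParFiveRecountLensSix.lens_point_bounds`).  For two lens points at distance `≥ d` with planar
inner product `P` one has `2P ≤ (3/5)(u + u') + (4/5) A − d²` (from `(h − h')² ≤ 2h² + 2h'²`,
`2h² ≤ (2/5)(A − u)`) and `2 r r' = u + u' − (r − r')²`; with the deficits `a = A − u`,
`b = A − u' ∈ [0, ρ² − d²] ⊂ [0, d²/4)` one has `(r − r')² (r + r')² = (a − b)² ≤ (a + b)(ρ² − d²)`
and `(r + r')² ≥ 4L ≥ (11/4) d²`, whence `5 (r − r')² ≤ a + b` and
`r r' ≥ (u + u')/2 − (a + b)/10 = (3/5)(u + u') − A/5`, so `r r' − 2P ≥ d² − A > 0` because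
`A = ρ² − ℓ²/4 < (5/4) d² − d²/4 = d²` (`planar_inner_lt_half'`), i.e. `cos (θ − θ') < 1/2` in
polar form `θ = arg (X + iY)`.  Six lens points would give six distinct directions; sorted, their
five consecutive gaps and the wrap-around gap are each `> π/3` and sum to `2π` — contradiction
(`Literature.Geometry.DiscreteGeometry.six_sorted_angles_false`, the Musin–Tarasov degree-five
pattern of `SphericalCodeContactGraph.lean`).  The coordinate statement is
`card_le_five_of_lens_coords'` (any finite index type, copied from
`ParFiveRecountLensPin.card_le_five_of_lens_coords`); the main theorem feeds it the frame
coordinates of the points of `S` (to pass from `ρ < (√5/2) d` to `ρ² < (5/4) d²` note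
`0 < d ≤ ℓ ≤ ρ`).  No interval arithmetic is needed.
-/

noncomputable section

namespace Summit.AtomisticToContinuum.Crystallization.Theorems.ParFiveRecountLensFive

open Real RealInnerProductSpace Literature.Geometry.DiscreteGeometry
  Summit.AtomisticToContinuum.Crystallization.Theorems.ParFiveRecountLensSix

/-! ### The strict planar angle bound below the ratio `√5/2` -/

/-- **Two lens points below the ratio `√5/2`: planar cosine `< 1/2`.** In the bounds of
`ParFiveRecountLensSix.lens_point_bounds` (planar radii `r, r' ≥ 0` with `r² = u`, `r'² = u'`,
mid-plane heights `h, h'`, `u + 5h² ≤ A := ρ² − ℓ²/4`, `L := d² − ℓ²/4 ≤ u`), if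
`0 < d ≤ ℓ ≤ ρ`, `ρ² < (5/4) d²`, and the two points are at distance `≥ d`, i.e.
`d² ≤ u + u' − 2P + (h − h')²` for the planar inner product `P`, then `2P < r r'`.
Indeed `2P ≤ (3/5)(u + u') + (4/5) A − d²` and `2 r r' = u + u' − (r − r')²`; with
`a = A − u`, `b = A − u' ∈ [0, ρ² − d²]`, `ρ² − d² < d²/4`, one has
`(r − r')² (r + r')² = (a − b)² ≤ (a + b)(ρ² − d²)` and `(r + r')² ≥ 4L ≥ (11/4) d²`
(as `r r' ≥ L > 0`), so `5 (r − r')² ≤ a + b`, `r r' ≥ (3/5)(u + u') − A/5` and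
`r r' − 2P ≥ d² − A > 0` since `A < (5/4) d² − d²/4 = d²`. [folklore] -/
theorem planar_inner_lt_half' {d ℓ ρ u u' h h' P r r' : ℝ} (hd : 0 < d) (hdl : d ≤ ℓ)
    (hlρ : ℓ ≤ ρ) (hρ5 : ρ ^ 2 < 5 / 4 * d ^ 2) (hr : 0 ≤ r) (hru : r ^ 2 = u) (hr' : 0 ≤ r')
    (hru' : r' ^ 2 = u') (hp : u + 5 * h ^ 2 ≤ ρ ^ 2 - ℓ ^ 2 / 4) (hlo : d ^ 2 - ℓ ^ 2 / 4 ≤ u)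
    (hp' : u' + 5 * h' ^ 2 ≤ ρ ^ 2 - ℓ ^ 2 / 4) (hlo' : d ^ 2 - ℓ ^ 2 / 4 ≤ u')
    (hsep : d ^ 2 ≤ u + u' - 2 * P + (h - h') ^ 2) : 2 * P < r * r' := by
  have hd2 : d ^ 2 ≤ ℓ ^ 2 := pow_le_pow_left₀ hd.le hdl 2
  have hℓ2 : ℓ ^ 2 ≤ ρ ^ 2 := pow_le_pow_left₀ (by linarith) hlρ 2
  have hdpos : 0 < d ^ 2 := pow_pos hd 2
  have hL : 0 < d ^ 2 - ℓ ^ 2 / 4 := by linarith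
  have hL4 : 11 / 4 * d ^ 2 ≤ 4 * (d ^ 2 - ℓ ^ 2 / 4) := by linarith
  -- the deficits `a = A - u`, `b = A - u'` lie in `[0, ρ² - d²]` and `ρ² - d² < d²/4`
  have ha : 0 ≤ ρ ^ 2 - ℓ ^ 2 / 4 - u := by linarith [sq_nonneg h]
  have hb : 0 ≤ ρ ^ 2 - ℓ ^ 2 / 4 - u' := by linarith [sq_nonneg h']
  have hab : 0 ≤ 2 * (ρ ^ 2 - ℓ ^ 2 / 4) - u - u' := by linarith
  have ht : ρ ^ 2 - d ^ 2 < d ^ 2 / 4 := by linarith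
  -- the product of the planar radii is at least `L = d² − ℓ²/4`
  have hrr : d ^ 2 - ℓ ^ 2 / 4 ≤ r * r' := by
    have h1 : (d ^ 2 - ℓ ^ 2 / 4) ^ 2 ≤ (r * r') ^ 2 := by
      rw [mul_pow, hru, hru', sq]
      exact mul_le_mul hlo hlo' hL.le (hL.le.trans hlo)
    exact (pow_le_pow_iff_left₀ hL.le (mul_nonneg hr hr') two_ne_zero).1 h1
  -- the two planar radii are close: `5 (r - r')² ≤ a + b`
  have hdiff : 5 * (r - r') ^ 2 ≤ 2 * (ρ ^ 2 - ℓ ^ 2 / 4) - u - u' := by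
    have hprod : (r - r') ^ 2 * (r + r') ^ 2 = (u - u') ^ 2 := by rw [← hru, ← hru']; ring
    have hsum : 4 * (d ^ 2 - ℓ ^ 2 / 4) ≤ (r + r') ^ 2 := by linarith [hrr, hru, hru', hlo, hlo']
    have huu : (u - u') ^ 2 ≤ (2 * (ρ ^ 2 - ℓ ^ 2 / 4) - u - u') * (ρ ^ 2 - d ^ 2) := by
      nlinarith [mul_nonneg ha (sub_nonneg.2 hlo), mul_nonneg hb (sub_nonneg.2 hlo'),
        mul_nonneg ha hb]
    by_contra hc
    have hc' := not_le.1 hc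
    have hpos : 0 < (r + r') ^ 2 := by linarith
    have key : (2 * (ρ ^ 2 - ℓ ^ 2 / 4) - u - u') * (4 * (d ^ 2 - ℓ ^ 2 / 4))
        < 5 * (u - u') ^ 2 :=
      calc (2 * (ρ ^ 2 - ℓ ^ 2 / 4) - u - u') * (4 * (d ^ 2 - ℓ ^ 2 / 4))
            ≤ (2 * (ρ ^ 2 - ℓ ^ 2 / 4) - u - u') * (r + r') ^ 2 :=
            mul_le_mul_of_nonneg_left hsum hab
        _ < 5 * (r - r') ^ 2 * (r + r') ^ 2 := mul_lt_mul_of_pos_right hc' hpos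
        _ = 5 * (u - u') ^ 2 := by rw [mul_assoc, hprod]
    have h3 : (2 * (ρ ^ 2 - ℓ ^ 2 / 4) - u - u') * (ρ ^ 2 - d ^ 2)
        ≤ (2 * (ρ ^ 2 - ℓ ^ 2 / 4) - u - u') * (d ^ 2 / 4) :=
      mul_le_mul_of_nonneg_left ht.le hab
    have h4 : (2 * (ρ ^ 2 - ℓ ^ 2 / 4) - u - u') * (11 / 4 * d ^ 2)
        ≤ (2 * (ρ ^ 2 - ℓ ^ 2 / 4) - u - u') * (4 * (d ^ 2 - ℓ ^ 2 / 4)) :=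
      mul_le_mul_of_nonneg_left hL4 hab
    nlinarith [key, huu, h3, h4, mul_nonneg hab hdpos.le]
  -- the main estimate
  have key : 2 * P ≤ 3 / 5 * (u + u') + 4 / 5 * (ρ ^ 2 - ℓ ^ 2 / 4) - d ^ 2 := by
    nlinarith [hsep, hp, hp', sq_nonneg (h + h')]
  have key2 : 2 * (r * r') = u + u' - (r - r') ^ 2 := by rw [← hru, ← hru']; ring
  have hAd : ρ ^ 2 - ℓ ^ 2 / 4 < d ^ 2 := by linarith
  linarith [key, key2, hdiff, hAd]

/-! ### Lens points in coordinates: at most five -/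

/-- **At most five lens points below the ratio `√5/2` (coordinate form).** With `x = 0`,
`y = (0, 0, ℓ)`, `0 < d ≤ ℓ ≤ ρ`, `ρ² < (5/4) d²`, a finite family of points `(Xᵢ, Yᵢ, Hᵢ)` with
`d ≤ |z x|, |z y| ≤ ρ` and pairwise distances `≥ d` has at most five members: `ρ ≤ (57/50) d`, so
in polar form `θᵢ = arg (Xᵢ + i Yᵢ)` (radii `> 0` by `lens_point_bounds`) any two directions
satisfy `cos (θᵢ − θₖ) < 1/2` (`planar_inner_lt_half'`), so the `θᵢ` are distinct, and six of
them, sorted, contradict `six_sorted_angles_false`. [folklore] -/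
theorem card_le_five_of_lens_coords' {d ℓ ρ : ℝ} (hd : 0 < d) (hdl : d ≤ ℓ) (hlρ : ℓ ≤ ρ)
    (hρ5 : ρ ^ 2 < 5 / 4 * d ^ 2) {ι : Type*} [Fintype ι] (X Y H : ι → ℝ)
    (hx1 : ∀ i, d ^ 2 ≤ X i ^ 2 + Y i ^ 2 + H i ^ 2)
    (hx2 : ∀ i, X i ^ 2 + Y i ^ 2 + H i ^ 2 ≤ ρ ^ 2)
    (hy1 : ∀ i, d ^ 2 ≤ X i ^ 2 + Y i ^ 2 + (H i - ℓ) ^ 2)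
    (hy2 : ∀ i, X i ^ 2 + Y i ^ 2 + (H i - ℓ) ^ 2 ≤ ρ ^ 2)
    (hsep : ∀ i k, i ≠ k → d ^ 2 ≤ (X i - X k) ^ 2 + (Y i - Y k) ^ 2 + (H i - H k) ^ 2) :
    Fintype.card ι ≤ 5 := by
  -- adapted from `ParFiveRecountLensPin.card_le_five_of_lens_coords`
  classical
  have hℓ2 : ℓ ^ 2 ≤ ρ ^ 2 := pow_le_pow_left₀ (by linarith) hlρ 2
  have hρ : ρ ≤ 57 / 50 * d := by
    by_contra hc
    have hc' := not_le.1 hc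
    nlinarith [mul_pos (sub_pos.2 hc') (show 0 < ρ + 57 / 50 * d by linarith), pow_pos hd 2]
  set r : ι → ℝ := fun i => ‖(⟨X i, Y i⟩ : ℂ)‖ with hrdef
  set θ : ι → ℝ := fun i => Complex.arg ⟨X i, Y i⟩ with hθdef
  have hrsq : ∀ i, r i ^ 2 = X i ^ 2 + Y i ^ 2 := by
    intro i
    simp only [hrdef, Complex.sq_norm, Complex.normSq_mk]
    ring
  have hr0 : ∀ i, 0 ≤ r i := fun i => norm_nonneg _
  have hpt : ∀ i, X i ^ 2 + Y i ^ 2 + 5 * (H i - ℓ / 2) ^ 2 ≤ ρ ^ 2 - ℓ ^ 2 / 4 ∧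
      d ^ 2 - ℓ ^ 2 / 4 ≤ X i ^ 2 + Y i ^ 2 :=
    fun i => lens_point_bounds hd hdl hlρ hρ (hx1 i) (hx2 i) (hy1 i) (hy2 i)
  have hrpos : ∀ i, 0 < r i := by
    intro i
    have h2 : 0 < r i ^ 2 := by rw [hrsq]; linarith [(hpt i).2, pow_pos hd 2]
    rcases (hr0 i).lt_or_eq with h | h
    · exact h
    · rw [← h] at h2; norm_num at h2
  have hX : ∀ i, X i = r i * cos (θ i) := fun i => (Complex.norm_mul_cos_arg ⟨X i, Y i⟩).symm
  have hY : ∀ i, Y i = r i * sin (θ i) := fun i => (Complex.norm_mul_sin_arg ⟨X i, Y i⟩).symm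
  -- the pairwise constraints: `cos (θ i - θ k) < 1/2`
  have hcos : ∀ i k, i ≠ k → cos (θ i - θ k) < 1 / 2 := by
    intro i k hik
    have hdot : X i * X k + Y i * Y k = r i * r k * cos (θ i - θ k) := by
      rw [hX i, hX k, hY i, hY k, cos_sub]; ring
    have hs : d ^ 2 ≤ (X i ^ 2 + Y i ^ 2) + (X k ^ 2 + Y k ^ 2) - 2 * (X i * X k + Y i * Y k)
        + ((H i - ℓ / 2) - (H k - ℓ / 2)) ^ 2 := by
      linarith [hsep i k hik]
    have hlt : 2 * (X i * X k + Y i * Y k) < r i * r k :=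
      planar_inner_lt_half' hd hdl hlρ hρ5 (hr0 i) (hrsq i) (hr0 k) (hrsq k) (hpt i).1 (hpt i).2
        (hpt k).1 (hpt k).2 hs
    rw [hdot] at hlt
    have hpos : 0 < r i * r k := mul_pos (hrpos i) (hrpos k)
    by_contra hc
    have := mul_le_mul_of_nonneg_left (not_lt.1 hc) hpos.le
    linarith
  have hθinj : Function.Injective θ := by
    intro i k hik
    by_contra hne
    have := hcos i k hne
    rw [hik, sub_self, cos_zero] at this
    norm_num at this
  -- six of the (distinct) directions, sorted
  by_contra hcard
  obtain ⟨T, hT, hTcard⟩ := Finset.exists_subset_card_eq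
    (show 6 ≤ (Finset.univ.image θ).card by
      rw [Finset.card_image_of_injective _ hθinj, Finset.card_univ]; omega)
  let e := T.orderEmbOfFin hTcard
  have hmem : ∀ k, ∃ i, θ i = e k := by
    intro k
    have := hT (T.orderEmbOfFin_mem hTcard k)
    rw [Finset.mem_image] at this
    obtain ⟨i, -, hi⟩ := this
    exact ⟨i, hi⟩
  choose π' hπ' using hmem
  refine six_sorted_angles_false (fun k => e k) e.strictMono ?_ ?_ ?_
  · show -π < e 0
    rw [← hπ' 0]
    exact Complex.neg_pi_lt_arg _
  · show e 5 ≤ π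
    rw [← hπ' 5]
    exact Complex.arg_le_pi _
  · intro i j hij
    have hne : π' i ≠ π' j := by
      intro h
      apply hij
      apply e.injective
      rw [← hπ' i, ← hπ' j, h]
    rw [← hπ' i, ← hπ' j]
    exact hcos _ _ hne

/-! ### The geometric statement -/

/-- **Lens capacity five below the ratio `√5/2`** (stub `stub_lensFive` of line `Sketch`, crux
`SquareWellLayerCake.AveragedTwelve`).  For `0 < d`, `ρ < (√5/2) d` and a near pair `x, y`
(`d ≤ |xy| ≤ ρ`), every finite `d`-separated set of points within `[d, ρ]` of both `x` and `y`
has at most five elements: `0 ≤ ρ` gives `ρ² < (5/4) d²`; take coordinates in a frame with third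
vector `(y − x)/|xy|` (`ParFiveRecountLensSix.exists_frame`) and apply
`card_le_five_of_lens_coords'` to the points of `S`. [folklore] -/
theorem stub_lensFive : ∀ (d ρ : ℝ), 0 < d → ρ < Real.sqrt 5 / 2 * d → ∀ (x y : EuclideanSpace ℝ (Fin 3)), d ≤ dist x y → dist x y ≤ ρ → ∀ (S : Finset (EuclideanSpace ℝ (Fin 3))), (∀ z ∈ S, d ≤ dist z x ∧ dist z x ≤ ρ ∧ d ≤ dist z y ∧ dist z y ≤ ρ) → (∀ z ∈ S, ∀ w ∈ S, z ≠ w → d ≤ dist z w) → S.card ≤ 5 := by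
  intro d ρ hd hρ x y hxy hxy' S hS hsep
  set ℓ := dist x y with hℓdef
  have hℓ : 0 < ℓ := hd.trans_le hxy
  have hρ0 : 0 ≤ ρ := (hℓ.trans_le hxy').le
  have hρ5 : ρ ^ 2 < 5 / 4 * d ^ 2 :=
    calc ρ ^ 2 < (Real.sqrt 5 / 2 * d) ^ 2 := pow_lt_pow_left₀ hρ hρ0 two_ne_zero
      _ = 5 / 4 * d ^ 2 := by
        rw [mul_pow, div_pow, Real.sq_sqrt (by norm_num : (0 : ℝ) ≤ 5)]; ring
  have hyx : ‖y - x‖ = ℓ := by rw [← dist_eq_norm, dist_comm]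
  obtain ⟨n, hn, hyxn⟩ : ∃ n : EuclideanSpace ℝ (Fin 3), ‖n‖ = 1 ∧ y - x = ℓ • n :=
    ⟨ℓ⁻¹ • (y - x), by
      rw [norm_smul, norm_inv, Real.norm_eq_abs, abs_of_pos hℓ, hyx, inv_mul_cancel₀ hℓ.ne'],
      by rw [smul_smul, mul_inv_cancel₀ hℓ.ne', one_smul]⟩
  obtain ⟨b, hb0, hb1, hnorm, hdiff⟩ := exists_frame hn
  have hX0 : ⟪b 0, y - x⟫ = 0 := by rw [hyxn, real_inner_smul_right, hb0, mul_zero]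
  have hY0 : ⟪b 1, y - x⟫ = 0 := by rw [hyxn, real_inner_smul_right, hb1, mul_zero]
  have hH0 : ⟪y - x, n⟫ = ℓ := by
    rw [hyxn, real_inner_smul_left, real_inner_self_eq_norm_sq, hn]; ring
  have hdx : ∀ z : EuclideanSpace ℝ (Fin 3), dist z x ^ 2
      = ⟪b 0, z - x⟫ ^ 2 + ⟪b 1, z - x⟫ ^ 2 + ⟪z - x, n⟫ ^ 2 := fun z => by
    rw [dist_eq_norm]; exact hnorm _
  have hdy : ∀ z : EuclideanSpace ℝ (Fin 3), dist z y ^ 2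
      = ⟪b 0, z - x⟫ ^ 2 + ⟪b 1, z - x⟫ ^ 2 + (⟪z - x, n⟫ - ℓ) ^ 2 := fun z => by
    rw [dist_eq_norm, ← sub_sub_sub_cancel_right z y x, hdiff, hX0, hY0, hH0, sub_zero,
      sub_zero]
  have hdd : ∀ z w : EuclideanSpace ℝ (Fin 3), dist z w ^ 2 = (⟪b 0, z - x⟫ - ⟪b 0, w - x⟫) ^ 2
      + (⟪b 1, z - x⟫ - ⟪b 1, w - x⟫) ^ 2 + (⟪z - x, n⟫ - ⟪w - x, n⟫) ^ 2 := fun z w => by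
    rw [dist_eq_norm, ← sub_sub_sub_cancel_right z w x, hdiff]
  refine (Fintype.card_coe S).symm.trans_le
    (card_le_five_of_lens_coords' hd hxy hxy' hρ5
      (fun z : S => ⟪b 0, (z : EuclideanSpace ℝ (Fin 3)) - x⟫)
      (fun z : S => ⟪b 1, (z : EuclideanSpace ℝ (Fin 3)) - x⟫)
      (fun z : S => ⟪(z : EuclideanSpace ℝ (Fin 3)) - x, n⟫) ?_ ?_ ?_ ?_ ?_)
  · intro z; rw [← hdx]; exact pow_le_pow_left₀ hd.le (hS z z.2).1 2
  · intro z; rw [← hdx]; exact pow_le_pow_left₀ dist_nonneg (hS z z.2).2.1 2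
  · intro z; rw [← hdy]; exact pow_le_pow_left₀ hd.le (hS z z.2).2.2.1 2
  · intro z; rw [← hdy]; exact pow_le_pow_left₀ dist_nonneg (hS z z.2).2.2.2 2
  · intro z w hzw; rw [← hdd]
    exact pow_le_pow_left₀ hd.le (hsep z z.2 w w.2 fun h => hzw (Subtype.ext h)) 2

end Summit.AtomisticToContinuum.Crystallization.Theorems.ParFiveRecountLensFive

end
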